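import Literature.AlgebraicGeometry.Motives.DifferentialsProofs
import Mathlib.AlgebraicGeometry.Modules.Tilde
import Mathlib.RingTheory.Smooth.StandardSmoothCotangent
import Mathlib.RingTheory.RingHom.LocallyStandardSmooth
import HarnessLib

/-!
# Discharged fact: `Ω¹_{X/k}` is locally free for `X` smooth over `k` (Hartshorne II.8.15)

`Literature.AlgebraicGeometry.Motives.Differentials` records as a named fact
(`Literature.isLocallyFree_cotangentSheaf : Prop`) that for a `k`-scheme `X` (`k` any commutative ring)
whose structure morphism `X → Spec k` is smooth of some relative dimension `n` (Mathlib's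
`SmoothOfRelativeDimension n`, i.e. locally standard smooth of relative dimension `n`), the
cotangent sheaf `Ω¹_{X/k}` (`Literature.cotangentSheaf X`, the sheafification of `U ↦ Ω_{Γ(X,U)/k}`) is a
locally free `𝒪_X`-module in Mathlib's sense `SheafOfModules.IsLocallyFree` (Stacks 01C6(1);
Hartshorne II.5, p. 109: `X` is covered by opens `U` with `Ω¹|_U` free). This is
R. Hartshorne, *Algebraic Geometry*, II Thm. 8.15 in the case of a nonsingular variety over an
algebraically closed field, III Ex. 10.0.2 for smooth morphisms in Hartshorne's sense, and in the
generality of the vendored statement The Stacks project, Tag 02G1 (Lemma 29.35.12: for `f : X → S`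
smooth, `Ω_{X/S}` is finite locally free). This file proves it
(`Literature.AlgebraicGeometry.Motives.isLocallyFree_cotangentSheaf_holds`); the statement is used verbatim, it is not weakened.

## Proof

We do not follow Hartshorne's stalk-wise proof of II.8.15 (via II.8.8 and regular local rings) but
the direct one behind Stacks 02G1, which is what the smoothness notion of the statement gives:

1. (`exists_free_sections_cotangentSheaf`) `X → Spec k` smooth means `k → Γ(X, U)` is a smooth ring
   map for every affine open `U` (smoothness is affine-local, Mathlib `HasRingHomProperty.appLE`),
   hence locally standard smooth (Stacks 00TA, Mathlib `RingHom.Smooth.locally_isStandardSmooth`):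
   every point has an affine (basic) open neighbourhood `V` with `k → Γ(X, V)` standard smooth, and
   then `Ω_{Γ(X,V)/k}` is a free `Γ(X, V)`-module (Stacks 00T7(2), Mathlib
   `IsStandardSmooth.free_kaehlerDifferential`). By the affine comparison
   `Γ(V, Ω¹_{X/k}) ≅ Ω_{Γ(X,V)/k}` (Hartshorne II Rem. 8.9.2, discharged in
   `DifferentialsProofs` as `bijective_toCotangentSheaf_app_holds`), `Γ(V, Ω¹_{X/k})` is free.
2. (`isLocalizing_cotangentSheaf_restrict`, `exists_free_iso_cotangentSheaf_restrict`) For an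
   affine open `V = Spec B`, the restriction of `Ω¹_{X/k}` along `Spec Γ(X, V) → X` is
   *localizing* (its sections on `D(f)` are the localization at `f` of its global sections:
   Hartshorne II Prop. 5.1(c),(d) for `(Ω_{B/k})~`, obtained here from II Prop. 8.2A,
   `Ω_{B_f/k} = (Ω_{B/k})_f`, through the (H1)/(H2) lemmas of `DifferentialsProofs`), hence by
   Mathlib's `isIso_fromTildeΓ_iff_isLocalizing` it is `Γ(V, Ω¹)~` (Hartshorne II Cor. 5.5), and
   `Γ(V, Ω¹) ≅ B^{(ι)}` gives `Ω¹|_{Spec B} ≅ (B^{(ι)})~ ≅ 𝒪^{(ι)}` (Mathlib `tildeFinsupp`).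
3. (`freeIsoOverOfFreeIsoRestrict`) Transport `𝒪^{(ι)} ≅ Ω¹|_{Spec Γ(X,V)}` along
   `V ≅ Spec Γ(X, V)` and the equivalence `Scheme.Modules.overEquiv V` to an isomorphism
   `𝒪^{(ι)} ≅ Ω¹.over V` of sheaves of modules on the over-site of `V`, which is the shape
   Mathlib's `SheafOfModules.IsLocallyFree` asks for (`mapFreeIso` for a colimit-preserving functor
   sending `𝒪` to `𝒪`).
4. (`isLocallyFree_of_forall_exists_free_iso_restrict`) Package the trivialisations, indexed by the
   points of `X`, as `LocalGeneratorsData` that `IsLocallyFreeData` (the comparison map of the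
   generating sections `(free.generatingSections ι).ofEpi e.hom` is `e.hom`, an isomorphism).

## References

* R. Hartshorne, *Algebraic Geometry*, GTM 52, Springer (1977), doi:10.1007/978-1-4757-3849-0:
  Ch. II §5 (locally free sheaves, p. 109; Prop. 5.1(c),(d); Cor. 5.5), Ch. II §8 (Prop. 8.2A,
  Rem. 8.9.2, Thm. 8.15), Ch. III §10 (Ex. 10.0.2). [Hartshorne1977]
* The Stacks project, Tags 00T7, 00TA (standard smooth algebras), 01C6 (locally free modules),
  02G1 (`Ω_{X/S}` of a smooth morphism is finite locally free). [StacksProject]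
-/

open CategoryTheory AlgebraicGeometry Opposite TopologicalSpace

universe u

namespace Literature.AlgebraicGeometry.Motives

/-! ### `Ω¹_{X/k}` on an affine open: the (H1)/(H2) properties on basic opens -/

section CotangentAffine

-- `TopCat.Presheaf`/`TopCat.Sheaf` are not reducible: as in Mathlib's `AlgebraicGeometry.Modules`.
set_option backward.isDefEq.respectTransparency false

variable {k : Type u} [CommRing k] (X : Over (Spec (CommRingCat.of k)))

/-- (H1) for the cotangent sheaf on an affine open `U`: a section of `Ω¹_{X/k}` over `U` vanishing
on the basic open `D(g)` (given as any open `W = D(g)`) is killed by a power of `g`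
(Hartshorne, *Algebraic Geometry*, II Lemma 5.3(a) for the quasi-coherent sheaf `Ω¹|_U = (Ω_{B/k})~`;
here from II Prop. 8.2A and Rem. 8.9.2). [cite: Hartshorne1977, II Lemma 5.3(a) and Rem. 8.9.2] -/
theorem cotangentSheaf_exists_pow_smul_eq_zero {U W : X.left.Opens} (hU : IsAffineOpen U)
    (g : Γ(X.left, U)) (hW : W = X.left.basicOpen g) (i : W ⟶ U)
    (y : (cotangentSheaf X).val.obj (op U))
    (hy : (cotangentSheaf X).val.map i.op y = 0) : ∃ n : ℕ, g ^ n • y = 0 := by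
  subst hW
  obtain ⟨p, rfl⟩ := (bijective_toCotangentSheaf_app_holds X hU).2 y
  have hi : i = homOfLE (X.left.basicOpen_le g) := Subsingleton.elim _ _
  subst hi
  have h1 : (toCotangentSheaf X).app _
      ((kaehlerPresheaf X).map (homOfLE (X.left.basicOpen_le g)).op p) = 0 := by
    rw [PresheafOfModules.naturality_apply]
    exact hy
  have h2 : (kaehlerPresheaf X).map (homOfLE (X.left.basicOpen_le g)).op p = 0 :=
    (bijective_toCotangentSheaf_app_holds X (hU.basicOpen g)).1 (h1.trans (map_zero _).symm)
  obtain ⟨n, hn⟩ := kaehlerPresheaf_exists_pow_smul_eq_zero X hU g p h2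
  refine ⟨n, ?_⟩
  change g ^ n • (toCotangentSheaf X).app (op U) p = 0
  rw [← ((toCotangentSheaf X).app (op U)).hom.map_smul, hn, map_zero]

/-- (H2) for the cotangent sheaf on an affine open `U`: every section of `Ω¹_{X/k}` over the basic
open `D(g)` (given as any open `W = D(g)`) becomes the restriction of a section over `U` after
multiplication by a power of `g` (Hartshorne, *Algebraic Geometry*, II Lemma 5.3(b) for
`Ω¹|_U = (Ω_{B/k})~`; here from II Prop. 8.2A and Rem. 8.9.2).
[cite: Hartshorne1977, II Lemma 5.3(b) and Rem. 8.9.2] -/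
theorem cotangentSheaf_exists_pow_smul_eq_map {U W : X.left.Opens} (hU : IsAffineOpen U)
    (g : Γ(X.left, U)) (hW : W = X.left.basicOpen g) (i : W ⟶ U)
    (x : (cotangentSheaf X).val.obj (op W)) :
    ∃ (n : ℕ) (y : (cotangentSheaf X).val.obj (op U)),
      X.left.presheaf.map i.op g ^ n • x = (cotangentSheaf X).val.map i.op y := by
  subst hW
  have hi : i = homOfLE (X.left.basicOpen_le g) := Subsingleton.elim _ _
  subst hi
  obtain ⟨q, rfl⟩ := (bijective_toCotangentSheaf_app_holds X (hU.basicOpen g)).2 x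
  obtain ⟨n, p, hp⟩ := kaehlerPresheaf_exists_pow_smul_eq_map X hU g q
  refine ⟨n, (toCotangentSheaf X).app (op U) p, ?_⟩
  change _ • (toCotangentSheaf X).app _ q = _
  rw [← ((toCotangentSheaf X).app _).hom.map_smul, hp, PresheafOfModules.naturality_apply]
  rfl

end CotangentAffine

/-! ### Sections of an `𝒪_Y`-module restricted to `Spec Γ(Y, V)` for an affine open `V` -/

section RestrictSpec

-- `TopCat.Presheaf`/`TopCat.Sheaf` are not reducible: as in Mathlib's `AlgebraicGeometry.Modules`.
set_option backward.isDefEq.respectTransparency false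

variable {Y : Scheme.{u}} {V : Y.Opens} (hV : IsAffineOpen V)

/-- `fromSpec(U') ⊆ V` for every open `U'` of `Spec Γ(Y, V)`. [folklore] -/
theorem fromSpec_image_le (U' : (Spec Γ(Y, V)).Opens) : hV.fromSpec ''ᵁ U' ≤ V :=
  (hV.fromSpec.image_le_opensRange U').trans hV.opensRange_fromSpec.le

/-- `fromSpec(Spec Γ(Y, V)) = V`. [folklore] -/
theorem fromSpec_image_top : hV.fromSpec ''ᵁ ⊤ = V := by
  rw [Scheme.Hom.image_top_eq_opensRange, hV.opensRange_fromSpec]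

/-- The ring identification: composing `Γ(Y,V) ≅ Γ(Spec Γ(Y,V), ⊤) → Γ(Spec Γ(Y,V), U')` with the
inverse of `fromSpec.appIso U' : Γ(Y, fromSpec(U')) ≅ Γ(Spec Γ(Y,V), U')` is the restriction map
`Γ(Y, V) → Γ(Y, fromSpec(U'))`. [folklore] -/
theorem ΓSpecIso_inv_map_appIso_inv (U' : (Spec Γ(Y, V)).Opens) :
    (Scheme.ΓSpecIso Γ(Y, V)).inv ≫ (Spec Γ(Y, V)).presheaf.map U'.leTop.op ≫
      (hV.fromSpec.appIso U').inv = Y.presheaf.map (homOfLE (fromSpec_image_le hV U')).op := by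
  have e : U' ≤ hV.fromSpec ⁻¹ᵁ V := by rw [hV.fromSpec_preimage_self]; exact le_top
  have h1 : hV.fromSpec.appLE V U' e = (Scheme.ΓSpecIso Γ(Y, V)).inv ≫
      (Spec Γ(Y, V)).presheaf.map U'.leTop.op := by
    rw [Scheme.Hom.appLE, hV.fromSpec_app_self, Category.assoc, ← Functor.map_comp,
      opens_op_hom_ext (_ ≫ _) U'.leTop.op]
  rw [← Category.assoc, ← h1, Scheme.Hom.appLE_appIso_inv]

/-- For an `𝒪_Y`-module `M` and an affine open `V`, the `Γ(Y, V)`-module structure on the sections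
of `M` restricted to `Spec Γ(Y, V)` over `U'` (that is, on `Γ(M, fromSpec(U'))`) is given by the
restriction map `Γ(Y, V) → Γ(Y, fromSpec(U'))`. [folklore] -/
theorem restrict_fromSpec_smul_def (M : Y.Modules) (U' : (Spec Γ(Y, V)).Opens) (r : Γ(Y, V))
    (x : Γ(M.restrict hV.fromSpec, U')) :
    r • x = Y.presheaf.map (homOfLE (fromSpec_image_le hV U')).op r •
        (show Γ(M, hV.fromSpec ''ᵁ U') from x) := by
  rw [Scheme.Modules.smul_Spec_def, ← ΓSpecIso_inv_map_appIso_inv hV U']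
  rfl

/-- Freeness of `Γ(M, V)` over `Γ(Y, V)` transfers to the `Γ(Y, V)`-module of global sections of
`M` restricted to `Spec Γ(Y, V)`, i.e. `Γ(M, fromSpec(Spec Γ(Y, V)))` (the module to which the `~`
construction is applied): restriction along the equality `fromSpec(Spec Γ(Y, V)) = V` is a
`Γ(Y, V)`-linear isomorphism. [folklore] -/
theorem free_sections_restrict_fromSpec (M : Y.Modules) [Module.Free Γ(Y, V) Γ(M, V)] :
    Module.Free Γ(Y, V)
      ((modulesSpecToSheaf.obj (M.restrict hV.fromSpec)).presheaf.obj (op ⊤)) := by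
  let e : Γ(M, V) ≃ₗ[Γ(Y, V)] Γ(M.restrict hV.fromSpec, ⊤) :=
    { (M.presheaf.mapIso (eqToIso (fromSpec_image_top hV)).op).addCommGroupIsoToAddEquiv with
      map_smul' := fun r x => by
        change M.presheaf.map (eqToHom (fromSpec_image_top hV)).op (r • x) =
          r • (show Γ(M.restrict hV.fromSpec, ⊤) from M.presheaf.map _ x)
        rw [restrict_fromSpec_smul_def, eqToHom_op,
          opens_op_hom_ext (eqToHom _) (homOfLE (fromSpec_image_le hV ⊤)).op]
        exact M.map_smul (homOfLE (fromSpec_image_le hV ⊤)) r x }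
  exact Module.Free.of_equiv e

end RestrictSpec

/-! ### `Ω¹_{X/k}` restricted to `Spec Γ(X, V)` is `Γ(V, Ω¹)~`, free when `Γ(V, Ω¹)` is -/

section CotangentRestrictSpec

-- `TopCat.Presheaf`/`TopCat.Sheaf` are not reducible: as in Mathlib's `AlgebraicGeometry.Modules`.
set_option backward.isDefEq.respectTransparency false

variable {k : Type u} [CommRing k] (X : Over (Spec (CommRingCat.of k)))
variable {V : X.left.Opens} (hV : IsAffineOpen V)

/-- The restriction of `Ω¹_{X/k}` to `Spec Γ(X, V) → X` (for an affine open `V`) is *localizing*: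
its sections over `D(f)` are the localization at `f` of its global sections
(Hartshorne, *Algebraic Geometry*, II Prop. 5.1(c),(d) for `Ω_{V/k} = (Ω_{B/k})~`, `V = Spec B`,
II Rem. 8.9.2; obtained from II Prop. 8.2A). [cite: Hartshorne1977, II Prop. 5.1(c) and Rem. 8.9.2] -/
theorem isLocalizing_cotangentSheaf_restrict :
    IsLocalizing (modulesSpecToSheaf.obj ((cotangentSheaf X).restrict hV.fromSpec)) := by
  intro f
  have hle₁ : hV.fromSpec ''ᵁ ⊤ ≤ V := fromSpec_image_le hV ⊤
  have hW₁ : IsAffineOpen (hV.fromSpec ''ᵁ ⊤) := by rw [fromSpec_image_top hV]; exact hV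
  have hW : hV.fromSpec ''ᵁ PrimeSpectrum.basicOpen f =
      X.left.basicOpen (X.left.presheaf.map (homOfLE hle₁).op f) := by
    rw [hV.fromSpec_image_basicOpen, Scheme.basicOpen_res, fromSpec_image_top hV, eq_comm,
      inf_eq_right]
    exact X.left.basicOpen_le f
  let i : hV.fromSpec ''ᵁ PrimeSpectrum.basicOpen f ⟶ hV.fromSpec ''ᵁ ⊤ :=
    homOfLE (hV.fromSpec.image_mono le_top)
  have hf : X.left.presheaf.map i.op (X.left.presheaf.map (homOfLE hle₁).op f) =
      X.left.presheaf.map (homOfLE (fromSpec_image_le hV (PrimeSpectrum.basicOpen f))).op f := by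
    rw [← CommRingCat.comp_apply, ← Functor.map_comp, opens_op_hom_ext (_ ≫ _) (homOfLE _).op]
  refine IsLocalizedModule.Away.mk_of_addCommGroup ?_ ?_ ?_
  · exact Scheme.Modules.isUnit_algebraMap_end_of_le_basicOpen f le_rfl
  · intro x
    obtain ⟨n, y, h⟩ := cotangentSheaf_exists_pow_smul_eq_map X hW₁ _ hW i x
    refine ⟨n, y, ?_⟩
    change f ^ n • (show Γ((cotangentSheaf X).restrict hV.fromSpec, PrimeSpectrum.basicOpen f)
      from x) = _
    rw [restrict_fromSpec_smul_def, map_pow, ← hf]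
    exact h
  · intro y hy
    obtain ⟨n, hn⟩ := cotangentSheaf_exists_pow_smul_eq_zero X hW₁ _ hW i y hy
    refine ⟨n, ?_⟩
    change f ^ n • (show Γ((cotangentSheaf X).restrict hV.fromSpec, ⊤) from y) = 0
    rw [restrict_fromSpec_smul_def, map_pow]
    exact hn

/-- Hence the restriction of `Ω¹_{X/k}` to `Spec Γ(X, V)` is `Γ(V, Ω¹)~`: the canonical map
`fromTildeΓ` is an isomorphism (Mathlib's `isIso_fromTildeΓ_iff_isLocalizing`; Hartshorne,
*Algebraic Geometry*, II Cor. 5.5 with II Rem. 8.9.2, `Ω_{V/k} ≅ (Ω_{B/k})~`).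
[cite: Hartshorne1977, II Rem. 8.9.2] -/
theorem isIso_fromTildeΓ_cotangentSheaf_restrict :
    IsIso ((cotangentSheaf X).restrict hV.fromSpec).fromTildeΓ :=
  (isIso_fromTildeΓ_iff_isLocalizing _).mpr (isLocalizing_cotangentSheaf_restrict X hV)

/-- If `Γ(V, Ω¹_{X/k})` (`≅ Ω_{Γ(X,V)/k}`) is a free `Γ(X, V)`-module, then the restriction of
`Ω¹_{X/k}` to `Spec Γ(X, V)` is a free `𝒪`-module: `Ω¹|_{Spec B} ≅ (B^{(ι)})~ ≅ 𝒪^{(ι)}`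
(Hartshorne, *Algebraic Geometry*, II Prop. 5.2(c) and Rem. 8.9.2; Mathlib `tildeFinsupp`).
[cite: Hartshorne1977, II Rem. 8.9.2] -/
theorem exists_free_iso_cotangentSheaf_restrict
    [Module.Free Γ(X.left, V) Γ(cotangentSheaf X, V)] :
    ∃ ι : Type u, Nonempty (SheafOfModules.free ι ≅ (cotangentSheaf X).restrict hV.fromSpec) := by
  haveI := free_sections_restrict_fromSpec hV (cotangentSheaf X)
  haveI := isIso_fromTildeΓ_cotangentSheaf_restrict X hV
  let N := (cotangentSheaf X).restrict hV.fromSpec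
  let Γ' := (modulesSpecToSheaf.obj N).presheaf.obj (op ⊤)
  let b := Module.Free.chooseBasis Γ(X.left, V) Γ'
  refine ⟨Module.Free.ChooseBasisIndex Γ(X.left, V) Γ', ⟨?_⟩⟩
  exact (tildeFinsupp _).symm ≪≫ (tilde.functor _).mapIso b.repr.toModuleIso.symm ≪≫
    asIso N.fromTildeΓ

end CotangentRestrictSpec

/-! ### Transport of trivialisations from `Spec Γ(Y, V)` to the over-site of `V` -/

section OverTransport

-- `TopCat.Presheaf`/`TopCat.Sheaf` are not reducible: as in Mathlib's `AlgebraicGeometry.Modules`.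
set_option backward.isDefEq.respectTransparency false

open SheafOfModules

variable {Y : Scheme.{u}} {V : Y.Opens} (hV : IsAffineOpen V)

/-- **Transport of a trivialisation to the over-site.** An isomorphism `𝒪^{(ι)} ≅ M|_{Spec Γ(Y,V)}`
of `𝒪_{Spec Γ(Y,V)}`-modules (`V` an affine open of `Y`) yields an isomorphism `𝒪^{(ι)} ≅ M.over V`
of sheaves of modules on the over-site of `V`: apply the functor
`G = ` (restriction along `V ≅ Spec Γ(Y, V)`) `⋙` (inverse of `Scheme.Modules.overEquiv V`), which
preserves colimits and the structure sheaf (so `G(𝒪^{(ι)}) ≅ 𝒪^{(ι)}`, Mathlib `mapFreeIso`), and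
identify `G(M|_{Spec Γ(Y,V)})` with `M.over V` (restriction along `Spec Γ(Y,V) ≅ V ↪ Y` is
restriction along `V ↪ Y`, which corresponds to `M.over V` under `overEquiv`). [folklore] -/
theorem nonempty_free_iso_over_of_free_iso_restrict (M : Y.Modules) {ι : Type u}
    (e : free ι ≅ M.restrict hV.fromSpec) : Nonempty (free ι ≅ M.over V) := by
  -- the transport functor and its two compatibilities
  let G : (Spec Γ(Y, V)).Modules ⥤ SheafOfModules.{u} (Y.ringCatSheaf.over V) :=
    Scheme.Modules.restrictFunctor hV.isoSpec.hom ⋙ (Scheme.Modules.overEquiv V).inverse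
  haveI : Limits.PreservesColimitsOfSize.{u, u} G := by
    dsimp only [G]
    infer_instance
  let η : unit _ ≅ G.obj (unit _) :=
    (TopologicalSpace.Opens.sheafOfModulesEquivOverInverseUnit V Y.ringCatSheaf).symm ≪≫
      (Scheme.Modules.overEquiv V).inverse.mapIso
        (Scheme.Modules.restrictUnitIso hV.isoSpec.hom).symm
  -- restricting along `V ≅ Spec Γ(Y, V)` and back is the identity
  let ρ : Scheme.Modules.restrictFunctor hV.isoSpec.inv ⋙
      Scheme.Modules.restrictFunctor hV.isoSpec.hom ≅ 𝟭 _ :=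
    (Scheme.Modules.restrictFunctorComp hV.isoSpec.hom hV.isoSpec.inv).symm ≪≫
      Scheme.Modules.restrictFunctorCongr hV.isoSpec.hom_inv_id ≪≫ Scheme.Modules.restrictFunctorId
  let θ : M.over V ≅ G.obj (M.restrict hV.fromSpec) :=
    (Scheme.Modules.overEquiv V).unitIso.app (M.over V) ≪≫
      (Scheme.Modules.overEquiv V).inverse.mapIso
        ((Scheme.Modules.overFunctorEquiv V).app M ≪≫ ρ.symm.app (M.restrict V.ι) ≪≫
          (Scheme.Modules.restrictFunctor hV.isoSpec.hom).mapIso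
            ((Scheme.Modules.restrictFunctorComp hV.isoSpec.inv V.ι).app M).symm)
  exact ⟨mapFreeIso G ι η ≪≫ G.mapIso e ≪≫ θ.symm⟩

end OverTransport

/-! ### Local freeness from affine-local trivialisations -/

section Assembly

-- `TopCat.Presheaf`/`TopCat.Sheaf` are not reducible: as in Mathlib's `AlgebraicGeometry.Modules`.
set_option backward.isDefEq.respectTransparency false

open SheafOfModules

variable {Y : Scheme.{u}}

/-- **Local freeness from affine-local trivialisations.** An `𝒪_Y`-module `M` such that every
point has an affine open neighbourhood `V` with `M|_{Spec Γ(Y,V)} ≅ 𝒪^{(ι)}` is locally free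
in Mathlib's sense `SheafOfModules.IsLocallyFree` (Stacks 01C6(1); Hartshorne, *Algebraic
Geometry*, II.5, p. 109): the `LocalGeneratorsData` indexed by the points of `Y` whose generating
sections on `V` are the images of the tautological sections of `𝒪^{(ι)}` under the transported
trivialisation `e : 𝒪^{(ι)} ≅ M.over V` are locally free data, their comparison maps being the
isomorphisms `e.hom`. [folklore] -/
theorem isLocallyFree_of_forall_exists_free_iso_restrict (M : Y.Modules)
    (h : ∀ y : Y, ∃ (V : Y.Opens) (hV : IsAffineOpen V), y ∈ V ∧
      ∃ ι : Type u, Nonempty (free ι ≅ M.restrict hV.fromSpec)) :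
    SheafOfModules.IsLocallyFree (R := Y.ringCatSheaf) M := by
  choose V hV hy ι e using h
  have hcov : (Opens.grothendieckTopology Y).CoversTop V :=
    (Opens.coversTop_iff _ V).mpr
      (TopologicalSpace.IsOpenCover.mk (top_le_iff.mp fun y _ => Opens.mem_iSup.mpr ⟨y, hy y⟩))
  have e' : ∀ y, free (ι y) ≅ M.over (V y) := fun y =>
    (nonempty_free_iso_over_of_free_iso_restrict (hV y) M (e y).some).some
  let q : LocalGeneratorsData (R := Y.ringCatSheaf) M :=
    { I := Y
      X := V
      coversTop := hcov
      generators := fun y => (free.generatingSections (ι y)).ofEpi (e' y).hom }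
  have hq : ∀ y, IsIso ((free.generatingSections (ι y)).ofEpi (e' y).hom).π := fun y => by
    rw [GeneratingSections.ofEpi_π]
    infer_instance
  haveI : q.IsLocallyFreeData := LocalGeneratorsData.IsLocallyFreeData.mk (q := q) hq
  exact q.isLocallyFree

end Assembly

/-! ### Smoothness gives free `Γ(V, Ω¹)` on small affine opens; the discharge -/

section Smooth

-- `TopCat.Presheaf`/`TopCat.Sheaf` are not reducible: as in Mathlib's `AlgebraicGeometry.Modules`.
set_option backward.isDefEq.respectTransparency false

variable {k : Type u} [CommRing k] (X : Over (Spec (CommRingCat.of k)))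

/-- If `X → Spec k` is smooth, then `k → Γ(X, V)` is a smooth ring map for every affine open `V`
(smoothness is affine-local on source and target: Mathlib `HasRingHomProperty.appLE` for
`Smooth`, applied to `Spec k = ⊤` and `V`). [folklore] -/
theorem smooth_constToPresheaf_app [Smooth X.hom] {V : X.left.Opens} (hV : IsAffineOpen V) :
    ((constToPresheaf X).app (op V)).hom.Smooth := by
  have h := HasRingHomProperty.appLE @Smooth X.hom ‹_› ⟨⊤, isAffineOpen_top _⟩ ⟨V, hV⟩ le_top
  have : (constToPresheaf X).app (op V) = (Scheme.ΓSpecIso (CommRingCat.of k)).inv ≫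
      X.hom.appLE ⊤ V le_top := rfl
  rw [this, CommRingCat.hom_comp]
  exact RingHom.Smooth.comp (RingHom.Smooth.of_bijective
    (ConcreteCategory.bijective_of_isIso (Scheme.ΓSpecIso (CommRingCat.of k)).inv)) h

/-- If `k → Γ(X, V)` is standard smooth (for the `k`-algebra structure of the `k`-scheme `X`) on
an affine open `V`, then `Γ(V, Ω¹_{X/k}) ≅ Ω_{Γ(X,V)/k}` is a free `Γ(X, V)`-module: `Ω` of a
standard smooth algebra is free (Stacks 00T7(2), Mathlib `IsStandardSmooth.free_kaehlerDifferential`)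
and `Γ(V, Ω¹_{X/k}) ≅ Ω_{Γ(X,V)/k}` (Hartshorne, *Algebraic Geometry*, II Rem. 8.9.2,
`bijective_toCotangentSheaf_app_holds`). [cite: StacksProject, Tag 00T7 (2)] -/
theorem free_sections_cotangentSheaf_of_isStandardSmooth {V : X.left.Opens} (hV : IsAffineOpen V)
    (h : ((constToPresheaf X).app (op V)).hom.IsStandardSmooth) :
    Module.Free Γ(X.left, V) Γ(cotangentSheaf X, V) := by
  letI algV : Algebra k Γ(X.left, V) := (((constToPresheaf X).app (op V)).hom).toAlgebra
  haveI : Algebra.IsStandardSmooth k Γ(X.left, V) := h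
  haveI : Module.Free Γ(X.left, V) ((kaehlerPresheaf X).obj (op V)) :=
    inferInstanceAs (Module.Free Γ(X.left, V) (KaehlerDifferential k Γ(X.left, V)))
  let l : (kaehlerPresheaf X).obj (op V) →ₗ[Γ(X.left, V)] Γ(cotangentSheaf X, V) :=
    ((toCotangentSheaf X).app (op V)).hom
  exact Module.Free.of_equiv (LinearEquiv.ofBijective l (bijective_toCotangentSheaf_app_holds X hV))

/-- Around every point of a smooth `k`-scheme there is an affine open `V` with `Γ(V, Ω¹_{X/k})`
free over `Γ(X, V)`: on an affine open neighbourhood `U`, the smooth ring map `k → Γ(X, U)` is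
locally standard smooth (Stacks 00TA, Mathlib `RingHom.Smooth.locally_isStandardSmooth`), i.e.
`k → Γ(X, U)_t = Γ(X, D(t))` is standard smooth for `t` in a set generating the unit ideal, so some
`D(t) ∋ x` will do (`free_sections_cotangentSheaf_of_isStandardSmooth`).
[cite: StacksProject, Tag 00TA] -/
theorem exists_free_sections_cotangentSheaf [Smooth X.hom] (x : X.left) :
    ∃ V : X.left.Opens, IsAffineOpen V ∧ x ∈ V ∧
      Module.Free Γ(X.left, V) Γ(cotangentSheaf X, V) := by
  obtain ⟨U, hU, hxU, -⟩ := exists_isAffineOpen_mem_and_subset (U := ⊤) (Set.mem_univ x)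
  obtain ⟨s, hs, hst⟩ := (RingHom.locally_iff_isLocalization RingHom.isStandardSmooth_respectsIso
    _).mp (smooth_constToPresheaf_app X hU).locally_isStandardSmooth
  obtain ⟨⟨t, ht⟩, hxt⟩ := Opens.mem_iSup.mp
    (hU.self_le_iSup_basicOpen_iff.mpr (by exact_mod_cast hs) hxU)
  refine ⟨X.left.basicOpen t, hU.basicOpen t, hxt, ?_⟩
  apply free_sections_cotangentSheaf_of_isStandardSmooth X (hU.basicOpen t)
  haveI := hU.isLocalization_basicOpen t
  have hfg : ((constToPresheaf X).app (op (X.left.basicOpen t))).hom =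
      (algebraMap Γ(X.left, U) Γ(X.left, X.left.basicOpen t)).comp
        ((constToPresheaf X).app (op U)).hom := by
    ext r
    have h := CategoryTheory.congr_fun
      ((constToPresheaf X).naturality (homOfLE (X.left.basicOpen_le t)).op) r
    simp only [Functor.const_obj_map, CommRingCat.comp_apply] at h
    exact h
  rw [hfg]
  exact hst t ht Γ(X.left, X.left.basicOpen t)

/-- **Discharge of `isLocallyFree_cotangentSheaf`** (Hartshorne, *Algebraic Geometry*, II Thm. 8.15:
for a nonsingular variety `X` over `k = k̄`, `Ω_{X/k}` is locally free of rank `dim X`; III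
Ex. 10.0.2 for smooth morphisms; Stacks 02G1 in the generality stated): if `X → Spec k` is smooth
of relative dimension `n` (locally standard smooth), then `Ω¹_{X/k}` is a locally free `𝒪_X`-module.
Proof: smooth ⇒ locally standard smooth ⇒ `Γ(V, Ω¹) ≅ Ω_{Γ(X,V)/k}` free on small affine opens `V`
(Stacks 00TA, 00T7; Hartshorne II Rem. 8.9.2); `Ω¹|_{Spec Γ(X,V)}` is localizing, hence
`≅ (Γ(V, Ω¹))~ ≅ 𝒪^{(ι)}` (Hartshorne II Prop. 5.1, Cor. 5.5, Prop. 8.2A); transport to the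
over-site of `V` and assemble `LocalGeneratorsData` indexed by the points of `X`.
[cite: Hartshorne1977, II Thm. 8.15 and Rem. 8.9.2] -/
theorem isLocallyFree_cotangentSheaf_holds : isLocallyFree_cotangentSheaf X := by
  intro n _
  haveI : Smooth X.hom := SmoothOfRelativeDimension.smooth n X.hom
  refine isLocallyFree_of_forall_exists_free_iso_restrict (cotangentSheaf X) fun x => ?_
  obtain ⟨V, hV, hxV, hfree⟩ := exists_free_sections_cotangentSheaf X x
  exact ⟨V, hV, hxV, exists_free_iso_cotangentSheaf_restrict X hV⟩

end Smooth

end Literature.AlgebraicGeometry.Motives
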